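import Literature.IUT.HodgeArakelov.BadPrimeGaussianMonoidsGenuineRecordRestrictionIsoOfThetaKummer
import Literature.IUT.HodgeArakelov.BadPrimeGaussianMonoidsCor36GenuineRecordThirdDisplayPair

/-!
# [IUTchII] Cor 3.6 (ii), third display `Ψ_{†F^Θ_v,α} ⥲ Ψ^ι_env(M^Θ_*) ⥲ Ψ_ξ(M^Θ_*) ⥲ Ψ_{Fξ}(†F_v)` AT THE GENUINE `θ_env` DATA over `ℚ̄_pˣ` —
# CLOSING DECL OF RECORD for sub-DAG row Cor-36.ii.r10 (proof-only): every [IUTchII]-internal input derived END-TO-END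

S. Mochizuki, *Inter-universal Teichmüller theory II*, kurims Dec-2020 manuscript, Cor 3.6 (ii) p. 100 l. 26–60, Cor 3.5 (ii) p. 95, Prop 2.2 (ii)
p. 66 [cite: Mochizuki2012, Cor 3.6 (ii) p.100]. Claim key DISPUTED (D-0012). PROOF-ONLY companion (abc-iut cell, layer L6, seat abc-iut-w4-d004
gen 4; node **IUTchII:Cor3.6(ii)**, row «COR36-r10-HORB» sequel). NO definition, NO `Prop` fact, NO instance. ONE theorem
**`exists_kummerRestrictionTransportIso'_toRecord_padic_of_evaluation_of_thetaKummer`** = abc-iut-w5-d192's composite (p436899) /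
`…_pairRhoLim` (p441016) with `horb` supplied by `horb_and_hroots_toRecord_inversion_of_thetaKummer` (file 9 of «COR35ii-HORB-GENUINE»), via
file 10's `exists_unique_restrictionIso'_toRecord_padic_of_evaluation_of_thetaKummer`. Hypotheses = the row's residual BY NAME: the [EtTh]
setting data + `IsEtThOrigin` + `CyclotomeTower`, the [EtTh] inversion datum `ι`, the FUNCTION-level [EtTh] Prop 1.4 package, the
`†F^Θ_v`-side Prop 3.3 (i) datum `K` with `iota (K.label α) =` the limit action of `ι`, the evaluation sections + `hact` + one finite-index
`ε`-image, the model data (`c`, `c₀`, `μ ⊆ O`), (E2) the presentation + VALUES of the theta function, `θ ∈ θ^{K.label α}_env(𝕄_*)`, a Kummer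
copy `e`. HONEST FRAMING: composition of landed theorems; nothing disputed is asserted; no side is taken on [IUTchIII] Cor 3.12; typed ≠ proved.
-/

noncomputable section

namespace Literature.IUT.HodgeArakelov

namespace EtaleLevels

open Literature.AnabelianGeometry.EtaleTheta (ContH1 ThetaSetting RootSystem cyclotome)
open Literature.AnabelianGeometry.EtaleTheta CohomologySystemOfContH1 EtaleThetaDataOfSetting TemperedThetaMonoids
  BadPrimeGaussianMonoids

variable {p : ℕ} [Fact p.Prime] {D : Literature.AnabelianGeometry.EtaleTheta.ThetaSetting p}
  {E : D.EtaleThetaData} {l : ℕ} (C : E.DoubleUnderline l) (hC : D.Compat) (hS : D.Sec2Hyps)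
  (hl : l.Prime) (hp2 : p ≠ 2) (hpl : p ≠ l) (hζ : ∃ ζ : D.K, IsPrimitiveRoot ζ (4 * l))
  (mods : ∀ M : ℕ+, D.CyclotomeMod l M)
  (f : contCocycles D.toTheta D.DeltaTheta C.GtpYdduu) (hf : f ∈ C.rootCocycles hC)
  (hmods : ∀ (M M' : ℕ+) (h : (M : ℕ) ∣ (M' : ℕ)) (x : D.lDeltaTheta l),
    MuN.red p M M' h ((mods M').red x) = (mods M).red x)
  (h15 : Literature.AnabelianGeometry.EtaleTheta.ThetaSetting.Prop15iii E hC) (L : C.CuspLabels)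
  (hZ : ∀ M : ℕ+, Nonempty (ModelCyclotomes.lDeltaQuot (C.rigidData (mods M) hC hS h15 L) ≃*
    Literature.IUT.HodgeTheaters.ZHat))
  (hcharY : EtaleThetaDataOfSetting.PiYddCharacteristic C)
  (hlim : Function.Bijective (rigidLimHom C hC hS hl hp2 hpl hζ mods f hf hmods h15 L hZ))
  [(EtaleThetaDataOfSetting.PiYdd C).Normal]
  [hYN : D.GtpYdd.Normal]
  (hO : D.IsEtThOrigin) {Es : Set ℕ+} (τc : D.CyclotomeTower l Es)
  -- the [EtTh] inversion datum
  (ι : D.PiTemp ≃ₜ* D.PiTemp) (hιX : C.Huu.map ι.toMulEquiv.toMonoidHom = C.Huu) (cι : ThetaSetting.ThetaCompanion ι)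
  (γ : Pi C) (hγ : C.toLZ γ = Multiplicative.ofAdd 1) (hZι : D.toZ (ι (γ : D.PiTemp)) = (D.toZ (γ : D.PiTemp))⁻¹)
  (δ : Pi C) (hιι : ∀ x : Pi C, ι (ι (x : D.PiTemp)) = (δ : D.PiTemp) * (x : D.PiTemp) * (δ : D.PiTemp)⁻¹)
  (hβ : ∀ a : D.GtpTheta, a ∈ D.DeltaTheta → cι.thetaIso a * a⁻¹ ∈ D.lDeltaTheta l)
  -- the FUNCTION-level [EtTh] Prop 1.4 package
  (T : D.ThetaKummerInput) (hη : E.etaDd = T.kummerTheta)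
  (hdeck : ∀ e' : D.PiTemp, e' ∈ D.GtpY → e' ∉ D.GtpYdd → e' • T.theta = T.const (-1) * T.theta)
  (ιFn : T.Fn →* T.Fn)
  (hιFn : ∀ (g : Pi C) (f : T.Fn), ιFn ((g : D.PiTemp) • f) = ι (g : D.PiTemp) • ιFn f)
  (hΛ : ∀ ζ : cyclotome T.Fn, ContH1Aut.coeffMap D.DeltaTheta cι.thetaIso (thetaCompanion_mem_deltaTheta ι cι)
      (T.coeff.hom ζ) = T.coeff.hom (cyclotome.map ιFn ζ))
  (hιθ : ιFn T.theta = T.const (-1) * T.theta)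
  {udd : T.Fn} (hu : udd ∈ MulAction.fixedPoints D.GtpYdd T.Fn) (xpow : ∀ m : ℤ, RootSystem (udd ^ m))
  (eexp : ℤ) (he : eexp ≠ 0)
  (hpow : ∀ k : ℤ, ∃ ck : (↥D.Kdd)ˣ, ((γ : D.PiTemp) ^ k) • T.theta = T.const ck * udd ^ (eexp * k) * T.theta)
  (hΛbij : Function.Bijective T.coeff.hom)
  (ord : T.Fn →* Multiplicative ℚ) (hordc : ∀ ck, ord (T.const ck) = 1) (hordu : ord udd ≠ 1)
  {d : ℕ} (hd : 0 < d)
  (hint : ∀ f ∈ MulAction.fixedPoints ((PiYdd C ⊓ ⊤).map C.Huu.subtype) T.Fn,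
    ∃ z : ℤ, Multiplicative.toAdd (ord f) = z / d)
  {Iota : Type}
  (iota : Iota → ((thetaEnvData C hC hS hl hp2 hpl hζ mods f hf hmods h15 L hZ hcharY hlim).D.coh.lim ≃+
    (thetaEnvData C hC hS hl hp2 hpl hζ mods f hf hmods h15 L hZ hcharY hlim).D.coh.lim))
  {Lbl : Type*} {P₀ : TopGroup.{0}} (φ₀ : P₀ →* D.GtpTheta) (s : Lbl → (P₀ →* Pi C))
  (hι : ∀ t, Continuous ((MonoidHom.id (Pi C)).comp (s t)))
  (hN : ∀ t, (⊤ : Subgroup P₀).map ((MonoidHom.id (Pi C)).comp (s t)) ≤ PiYdd C)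
  (hφ : ∀ t, (phi C).comp ((MonoidHom.id (Pi C)).comp (s t)) = φ₀)


section Padic

variable [TopologicalSpace (PadicAlgCl p)ˣ]
  (c : CyclotomeCoefficients (phi C) (D.lDeltaTheta l) (PadicAlgCl p)ˣ)
  (hA : ∀ b : (PadicAlgCl p)ˣ, IsOpen (MulAction.stabilizer (Pi C) b : Set (Pi C)))
  (hfi : ∀ b : (PadicAlgCl p)ˣ, (MulAction.stabilizer (Pi C) b).FiniteIndex)
  (O : Submonoid (PadicAlgCl p)ˣ)
  [MulDistribMulAction P₀ (PadicAlgCl p)ˣ]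
  (c₀ : CyclotomeCoefficients φ₀ (D.lDeltaTheta l) (PadicAlgCl p)ˣ)
  (hA₀ : ∀ b : (PadicAlgCl p)ˣ, IsOpen (MulAction.stabilizer P₀ b : Set P₀))
  (hfi₀ : ∀ b : (PadicAlgCl p)ˣ, (MulAction.stabilizer P₀ b).FiniteIndex)
  -- the module of FUNCTIONS with its Kummer data over `Π^tp_{Ÿ̲̲}` (abc-iut-w4-d004 …RestrictionIsoOfEvaluation)
  {Afun : Type} [CommGroup Afun] [MulDistribMulAction (Pi C) Afun] [TopologicalSpace Afun] [RootableBy Afun ℕ]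
  (cf : CyclotomeCoefficients (phi C) (D.lDeltaTheta l) Afun)
  (hAf : ∀ a : Afun, IsOpen (MulAction.stabilizer (Pi C) a : Set (Pi C)))
  (hfif : ∀ a : Afun, (MulAction.stabilizer (Pi C) a).FiniteIndex)


include hS hO τc hγ hZι hιι hβ hη hdeck hιFn hΛ hιθ hu xpow he hpow hΛbij hordc hordu hd hint in
/-- **CLOSING DECL OF RECORD (row Cor-36.ii.r10): `horb` supplied END-TO-END from the [EtTh] inversion datum + the FUNCTION-level [EtTh] Prop 1.4 package (`iota (K.label α) =` the limit action of `ι`).** **[Cor-36.ii.r10] `Ψ_{†F^Θ_v,α} ⥲ Ψ^ι_env(𝕄_*) ⥲ Ψ_ξ(𝕄_*) ⥲ Ψ_{Fξ}(†F_v)` END-TO-END AT THE GENUINE `θ_env` DATA over `ℚ̄_pˣ`**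
([IUTchII] Cor 3.6 (ii) third display, p. 100 l. 26–60), any inversion family `iota`: for ANY `†F^Θ_v`-side Kummer datum `K`
(Prop 3.3 (i), abc-iut-L6-t2's `Prop33KummerStatements.kummerTheta`) over the genuine record and ANY Kummer copy `e : N ⥲ κ₀(O)` of
the labeled constants (Cor 3.6 (i)), the COMPOSITE `Φ : Ψ_{†F^Θ_v,α} ⥲ Ψ_{Fξ}(†F_v)` exists, pinned: `piIso e ∘ Φ = restriction ∘
kummerTheta`. The restriction isomorphism is abc-iut-w4-d004's `exists_unique_restrictionIso'_toRecord_padic_of_evaluation` —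
(K), (R), (E), `hU`, `hUsurj`, `hinj`, `hq₀` ALL DERIVED from: the evaluation sections, the model data, a module of functions with
Kummer data and evaluations equivariant along the sections, the presentation `θ = κ_fun(fΘ)` and the values `ev_t fΘ = q_t ∈ O`
(`q_{t₀}` non-unit), `θ ∈ θ^{label α}_env(𝕄_*)`, `horb`. [cite: Mochizuki2012, Cor 3.6 (ii) p.100] -/
theorem exists_kummerRestrictionTransportIso'_toRecord_padic_of_evaluation_of_thetaKummer (hc : Function.Bijective c.hom)
    -- `μ ⊆ O` (with inverses)
    (hOtors : ∀ a : (PadicAlgCl p)ˣ, IsOfFinOrder a → a ∈ O ∧ a⁻¹ ∈ O)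
    (hc₀ : Function.Bijective c₀.hom) (hc₀c : ∀ ζ, c₀.hom ζ = c.hom ζ)
    (hact : ∀ (t : Lbl) (g : P₀) (a : (PadicAlgCl p)ˣ), g • a = s t g • a) (t₁ : Lbl)
    [((EtaleThetaDataOfSetting.aug C).comp (s t₁)).range.FiniteIndex]
    {F : TemperedFrobenioidThetaData.{0, 0} (modelSystem C hC hS hl hp2 hpl hζ mods f hf hmods h15 L hZ).PiX}
    (K : Prop33KummerStatements
      ((thetaEnvData C hC hS hl hp2 hpl hζ mods f hf hmods h15 L hZ hcharY hlim).toRecord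
          (h1LimConjMulAut (phi C) (D.lDeltaTheta l) (PiYdd C))
          (h1LimKummerOn (phi C) (D.lDeltaTheta l) (PiYdd C) c hA hfi O) iota) F)
    (α : (modelSystem C hC hS hl hp2 hpl hζ mods f hf hmods h15 L hZ).PiX)
    {θ : ((thetaEnvData C hC hS hl hp2 hpl hζ mods f hf hmods h15 L hZ hcharY hlim).toRecord
          (h1LimConjMulAut (phi C) (D.lDeltaTheta l) (PiYdd C))
          (h1LimKummerOn (phi C) (D.lDeltaTheta l) (PiYdd C) c hA hfi O) iota).H}
    (hθ : θ ∈ ((thetaEnvData C hC hS hl hp2 hpl hζ mods f hf hmods h15 L hZ hcharY hlim).toRecord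
          (h1LimConjMulAut (phi C) (D.lDeltaTheta l) (PiYdd C))
          (h1LimKummerOn (phi C) (D.lDeltaTheta l) (PiYdd C) c hA hfi O) iota).thetaEnv (K.label α))
    (hi₀ : iota (K.label α) = pairRhoLim C (inversionAlpha C ι hιX) cι.thetaIso (thetaCompanion_phi C ι hιX cι)
      (mem_lDeltaTheta_iff_thetaCompanion ι cι l) (mem_PiYdd_iff_of_piYddCharacteristic C hcharY _))
    (R : Lbl → (((thetaEnvData C hC hS hl hp2 hpl hζ mods f hf hmods h15 L hZ hcharY hlim).toRecord
          (h1LimConjMulAut (phi C) (D.lDeltaTheta l) (PiYdd C))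
          (h1LimKummerOn (phi C) (D.lDeltaTheta l) (PiYdd C) c hA hfi O) iota).H →*
      Multiplicative (h1Lim φ₀ (D.lDeltaTheta l) (⊤ : Subgroup P₀) ⊥)))
    (hR : ∀ t y, Multiplicative.toAdd (R t y) =
      h1LimCongr (D.lDeltaTheta l) ⊤ (hφ t) ⊥
        (h1LimComap (phi C) (D.lDeltaTheta l) ((MonoidHom.id (Pi C)).comp (s t)) (hι t) (hN t)
          (AddEquiv.additiveMultiplicative (h1Lim (phi C) (D.lDeltaTheta l) (PiYdd C) ⊥) (Additive.ofMul y))))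
    (ev : Lbl → (Afun →* (PadicAlgCl p)ˣ)) (hev : ∀ (t : Lbl) (g : P₀) (a : Afun), ev t (s t g • a) = g • ev t a)
    (hcev : ∀ (t : Lbl) (ζ : cyclotome Afun), c₀.hom (cyclotome.map (ev t) ζ) = cf.hom ζ)
    {fΘ : Afun}
    (hθf : AddEquiv.additiveMultiplicative (h1Lim (phi C) (D.lDeltaTheta l) (PiYdd C) ⊥) (Additive.ofMul θ) =
      Multiplicative.toAdd (h1LimKummer (phi C) (D.lDeltaTheta l) (PiYdd C) cf hAf hfif fΘ))
    (q : Lbl → O) (hval : ∀ t, ev t fΘ = (q t : (PadicAlgCl p)ˣ)) (t₀ : Lbl) (hq : ¬ IsUnit (q t₀))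
    {N : Type*} [CommMonoid N] (e : N ≃* MonoidHom.mrange (h1LimKummerOn φ₀ (D.lDeltaTheta l) ⊤ c₀ hA₀ hfi₀ O)) :
    ∃ Φ : F.frobThetaMonoid α ≃*
        frobenioidGaussianMonoid e (fun t =>
          (fun t =>
          ((R t).comp (((thetaEnvData C hC hS hl hp2 hpl hζ mods f hf hmods h15 L hZ hcharY hlim).toRecord
          (h1LimConjMulAut (phi C) (D.lDeltaTheta l) (PiYdd C))
          (h1LimKummerOn (phi C) (D.lDeltaTheta l) (PiYdd C) c hA hfi O) iota).thetaMonoid (K.label α)).subtype).codRestrict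
            (MonoidHom.mrange (h1LimKummerOn φ₀ (D.lDeltaTheta l) ⊤ c₀ hA₀ hfi₀ O))
            (restriction_mem_mrange_gen
              ((thetaEnvData C hC hS hl hp2 hpl hζ mods f hf hmods h15 L hZ hcharY hlim).toRecord
          (h1LimConjMulAut (phi C) (D.lDeltaTheta l) (PiYdd C))
          (h1LimKummerOn (phi C) (D.lDeltaTheta l) (PiYdd C) c hA hfi O) iota)
              (h1LimKummerOn (phi C) (D.lDeltaTheta l) (PiYdd C) c hA hfi O)
              (h1LimKummerOn φ₀ (D.lDeltaTheta l) ⊤ c₀ hA₀ hfi₀ O)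
              (fun t => (R t).comp (((thetaEnvData C hC hS hl hp2 hpl hζ mods f hf hmods h15 L hZ hcharY hlim).toRecord
          (h1LimConjMulAut (phi C) (D.lDeltaTheta l) (PiYdd C))
          (h1LimKummerOn (phi C) (D.lDeltaTheta l) (PiYdd C) c hA hfi O) iota).thetaMonoid (K.label α)).subtype)
              q (hκ_padic C c hA hfi O hc) (ThetaEnvData.toRecord_constantMonoid _ _ _ _) hθ
              (horb_and_hroots_toRecord_inversion_of_thetaKummer C hC hS hl hp2 hpl hζ mods f hf hmods h15 L hZ hcharY hlim hO τc
                ι hιX cι γ hγ hZι δ hιι hβ T hη hdeck ιFn hιFn hΛ hιθ hu xpow eexp he hpow hΛbij ord hordc hordu hd hint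
                iota c hA hfi O hc hOtors hi₀ hθ).1
              (fun t m hm => hRκ_toRecord C hC hS hl hp2 hpl hζ mods f hf hmods h15 L hZ hcharY hlim iota φ₀ s hι hN hφ c
                hA hfi O c₀ hA₀ hfi₀ hc₀c hact R hR t m hm)
              (fun t => hRθ_toRecord_of_evaluation C hC hS hl hp2 hpl hζ mods f hf hmods h15 L hZ hcharY hlim iota φ₀ s hι hN
                hφ c hA hfi O c₀ hA₀ hfi₀ cf hAf hfif R hR ev hev hcev hθf q hval t) t)) t
            ⟨θ, thetaEnv_subset_thetaMonoid
              ((thetaEnvData C hC hS hl hp2 hpl hζ mods f hf hmods h15 L hZ hcharY hlim).toRecord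
          (h1LimConjMulAut (phi C) (D.lDeltaTheta l) (PiYdd C))
          (h1LimKummerOn (phi C) (D.lDeltaTheta l) (PiYdd C) c hA hfi O) iota) (K.label α) hθ⟩),
      ∀ x, piIso Lbl e ((Φ x : frobenioidGaussianMonoid e _) : Lbl → N) =
        MonoidHom.pi
          (fun t =>
          ((R t).comp (((thetaEnvData C hC hS hl hp2 hpl hζ mods f hf hmods h15 L hZ hcharY hlim).toRecord
          (h1LimConjMulAut (phi C) (D.lDeltaTheta l) (PiYdd C))
          (h1LimKummerOn (phi C) (D.lDeltaTheta l) (PiYdd C) c hA hfi O) iota).thetaMonoid (K.label α)).subtype).codRestrict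
            (MonoidHom.mrange (h1LimKummerOn φ₀ (D.lDeltaTheta l) ⊤ c₀ hA₀ hfi₀ O))
            (restriction_mem_mrange_gen
              ((thetaEnvData C hC hS hl hp2 hpl hζ mods f hf hmods h15 L hZ hcharY hlim).toRecord
          (h1LimConjMulAut (phi C) (D.lDeltaTheta l) (PiYdd C))
          (h1LimKummerOn (phi C) (D.lDeltaTheta l) (PiYdd C) c hA hfi O) iota)
              (h1LimKummerOn (phi C) (D.lDeltaTheta l) (PiYdd C) c hA hfi O)
              (h1LimKummerOn φ₀ (D.lDeltaTheta l) ⊤ c₀ hA₀ hfi₀ O)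
              (fun t => (R t).comp (((thetaEnvData C hC hS hl hp2 hpl hζ mods f hf hmods h15 L hZ hcharY hlim).toRecord
          (h1LimConjMulAut (phi C) (D.lDeltaTheta l) (PiYdd C))
          (h1LimKummerOn (phi C) (D.lDeltaTheta l) (PiYdd C) c hA hfi O) iota).thetaMonoid (K.label α)).subtype)
              q (hκ_padic C c hA hfi O hc) (ThetaEnvData.toRecord_constantMonoid _ _ _ _) hθ
              (horb_and_hroots_toRecord_inversion_of_thetaKummer C hC hS hl hp2 hpl hζ mods f hf hmods h15 L hZ hcharY hlim hO τc
                ι hιX cι γ hγ hZι δ hιι hβ T hη hdeck ιFn hιFn hΛ hιθ hu xpow eexp he hpow hΛbij ord hordc hordu hd hint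
                iota c hA hfi O hc hOtors hi₀ hθ).1
              (fun t m hm => hRκ_toRecord C hC hS hl hp2 hpl hζ mods f hf hmods h15 L hZ hcharY hlim iota φ₀ s hι hN hφ c
                hA hfi O c₀ hA₀ hfi₀ hc₀c hact R hR t m hm)
              (fun t => hRθ_toRecord_of_evaluation C hC hS hl hp2 hpl hζ mods f hf hmods h15 L hZ hcharY hlim iota φ₀ s hι hN
                hφ c hA hfi O c₀ hA₀ hfi₀ cf hAf hfif R hR ev hev hcev hθf q hval t) t))
          (K.kummerTheta α x) := by
  obtain ⟨eΨ, heΨ, -⟩ :=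
    exists_unique_restrictionIso'_toRecord_padic_of_evaluation_of_thetaKummer C hC hS hl hp2 hpl hζ mods f hf hmods h15 L hZ
      hcharY hlim hO τc ι hιX cι γ hγ hZι δ hιι hβ T hη hdeck ιFn hιFn hΛ hιθ hu xpow eexp he hpow hΛbij ord hordc hordu hd hint
      iota φ₀ s hι hN hφ c hA hfi O c₀ hA₀ hfi₀ cf hAf hfif hc hOtors hc₀ hc₀c hact t₁ hi₀ hθ R hR ev hev hcev hθf q hval t₀ hq
  exact exists_kummerRestrictionTransportIso' K α _ eΨ heΨ e

end Padic

end EtaleLevels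

end Literature.IUT.HodgeArakelov

end
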